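import Literature.Claims.NS.Zeroual2026
import Literature.Analysis.PDE.LoewnerNirenbergFacts
import Literature.Analysis.FluidPDE.LerayHopfMild
import Literature.Analysis.FluidPDE.NewtonKernel
import Literature.Barriers.NavierStokesRegularity.InstantaneousTypeIBlowupDecomposition
import Summits.NavierStokesRegularity.NavierStokesRegularity.Theorems.SoloRefuteMagsanop2026
import Mathlib.MeasureTheory.Measure.Haar.NormedSpace
import HarnessLib

/-!
# C157 `Zeroual2026` — refutation of `Step1_Thm41` (Theorem 4.1 (4.1) p.7 with Definition 2.4 (2.6) p.5)

D-0090 NS-CLAIMS SWEEP, refuter of record ns-claims-refuter-4 g5. TEXT OF RECORD: I. Zeroual, Zenodo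
record 19374469 (2026), 12 pp. (census pin `census/texts/Zeroual2026/`, PDF sha16 67ed76c3a8cda1df).
Skeleton: `Literature/Claims/NS/Zeroual2026.lean` (ns-claims-typist-4 g5, p527790).

## What is refuted, and how
`Step1_Thm41 K` types Theorem 4.1 (4.1) p.7 l.10–42 with Definition 2.4 (2.6) p.5 l.49–65: the constant
`C*_L = K.Cstar` is a lower bound of the quotient `‖Au‖²_{L²} / ‖u‖²_{L² log L}` over `D(A)` AND is
positive («C*_L = inf_{u ∈ D(A), u ≢ 0} ‖Au‖²_{L²}/‖u‖²_{L² log L} > 0 … independent of the solution u»).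
The quotient is scale-covariant (the text's own Remark 2.5 p.5: «[C*_L] = [L⁻⁴]»): for the spread-out
dilations `U_{a,b}(x) = a U(b x)`, `b → 0⁺`, of ONE smooth compactly supported divergence-free field `U`
(the tree's Ramm test datum, `curl` of a bump), `‖ΔU_{a,b}‖²_{L²} = a² b · ‖ΔU‖²_{L²}` while
`‖U_{a,b}‖²_{L² log L} ≥ ‖U_{a,b}‖²_{L²} = a² b⁻³ ‖U‖²_{L²}` (`log(e + t) ≥ 1`), so the quotient is
`≤ b⁴ · const → 0` (the amplitude cancels) and NO positive constant bounds it from below: for every `K`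
with `0 < K.Cstar` some `U_{1,b} ∈ D(A)` violates `K.Cstar · ‖u‖²_{L² log L} ≤ ‖Δu‖²_{L²}`. Every
`U_{a,b}` is `C^∞`, compactly supported, divergence-free, with `U_{a,b}, ΔU_{a,b} ∈ L²` — inside the
typed class `InDA` (and inside the printed `D(A) = H² ∩ {∇·u = 0}`), so this is a countermodel to the
display as printed, not a junk instance.
KILL ROUTE 2 → 3 (README): scaling audit decided by one explicit field.

Main results (namespace `Summit.NavierStokesRegularity.NavierStokesRegularity.Theorems.Zeroual2026`):
* `stokesSq_fam`, `l2Sq_fam`, `l2Sq_le_olSq` — the scaling laws and the Orlicz lower bound (the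
  elementary `1 ≤ log(e + s)` is the landed `Literature.Barriers.NavierStokesRegularity.one_le_log_exp_one_add`);
* `inDA_fam` — the family lies in the typed class `D(A)`;
* `exists_violator` — for every `c > 0` and every amplitude `a ≠ 0` a member of the family with
  `‖ΔU_{a,b}‖² < c · ‖U_{a,b}‖²_{L² log L}` (amplitude-free: also sinks the energy-ball variant);
* `not_Step1_Thm41 : ∀ K, ¬ Step1_Thm41 K` — the headline (TYPE = `¬` the skeleton decl, for every
  constants package `K`, as the skeleton prescribes: «a kill is `∀ K, ¬ Step_k K`»).

## References
* [Zeroual2026] I. Zeroual, «Global Regularity of 3D Incompressible Navier–Stokes Equations: A Complete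
  Proof via Orlicz–Zygmund Spectral Stability and Natural Damping Frequency», Zenodo 19374469 (2026).
* [FeffermanClay2006] C. L. Fefferman, «Existence and smoothness of the Navier–Stokes equation», CMI (2006).

WHAT THIS IS NOT: not a claim about NS regularity or blow-up; not a claim about any author beyond the
typed locator.
-/

noncomputable section

set_option linter.dupNamespace false

open MeasureTheory Set Filter Function Metric
open scoped Topology ENNReal ContDiff Laplacian

namespace Summit.NavierStokesRegularity.NavierStokesRegularity.Theorems.Zeroual2026

open Literature.Analysis.FluidPDE Literature.Claims.NS.Zeroual2026
open Summit.NavierStokesRegularity.NavierStokesRegularity.Theorems.Magsanop2026 (scaleField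
  scaleField_apply contDiff_scaleField hasCompactSupport_scaleField isDivFree_scaleField)
open Summit.NavierStokesRegularity.NavierStokesRegularity.Theorems.Ramm2024 (testDatum contDiff_testDatum
  hasCompactSupport_testDatum isDivFree_testDatum testDatum_ne_zero)

/-! ## `L²` bookkeeping for continuous compactly supported fields -/

/-- Square-integrability of a continuous compactly supported field. [folklore] -/
theorem integrable_sq {g : E3 → E3} (hg : Continuous g) (hc : HasCompactSupport g) :
    Integrable (fun x => ‖g x‖ ^ 2) :=
  (hg.norm.pow 2).integrable_of_hasCompactSupport (hc.norm.comp_left (zero_pow two_ne_zero))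

/-- Pointwise: `‖g x‖ₑ² = ‖(‖g x‖²)‖ₑ`. [folklore] -/
theorem enorm_sq_eq (g : E3 → E3) (x : E3) : ‖g x‖ₑ ^ 2 = ‖(‖g x‖ ^ 2)‖ₑ := by
  rw [← ofReal_norm, ← ENNReal.ofReal_pow (norm_nonneg _), Real.enorm_eq_ofReal (sq_nonneg _)]

/-- `∫⁻ ‖g‖ₑ² < ∞` for a continuous compactly supported field. [folklore] -/
theorem lintegral_enorm_sq_lt_top {g : E3 → E3} (hg : Continuous g) (hc : HasCompactSupport g) :
    (∫⁻ x, ‖g x‖ₑ ^ 2) < ⊤ := by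
  simp_rw [enorm_sq_eq]
  exact (integrable_sq hg hc).2

/-- The skeleton's `l2Sq` (via `∫⁻`) is the Bochner integral `∫ ‖g‖²` for a continuous field.
[folklore] -/
theorem l2Sq_eq_integral {g : E3 → E3} (hg : Continuous g) : l2Sq g = ∫ x, ‖g x‖ ^ 2 := by
  unfold l2Sq
  rw [integral_eq_lintegral_of_nonneg_ae (Eventually.of_forall fun x => sq_nonneg _)
    ((hg.norm.pow 2).aestronglyMeasurable)]
  congr 1
  refine lintegral_congr fun x => ?_
  rw [← ofReal_norm, ENNReal.ofReal_pow (norm_nonneg _)]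

/-- **The Orlicz functional dominates the `L²` mass**: `‖g‖²_{L²} ≤ ‖g‖²_{L² log L}` ((2.5) p.5 with
`log(e + |g|/‖g‖_{L²}) ≥ 1`, landed `one_le_log_exp_one_add`), for continuous compactly supported `g`. [cite: Zeroual2026, Def 2.3 (2.5) p.5 l.32–48] -/
theorem l2Sq_le_olSq {g : E3 → E3} (hg : Continuous g) (hc : HasCompactSupport g) : l2Sq g ≤ olSq g := by
  rw [l2Sq_eq_integral hg]
  unfold olSq
  set s : ℝ := l2 g
  have hs : 0 ≤ s := Real.sqrt_nonneg _
  have hpos : ∀ x, 0 < Real.exp 1 + ‖g x‖ / s := fun x =>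
    add_pos_of_pos_of_nonneg (Real.exp_pos 1) (div_nonneg (norm_nonneg _) hs)
  have hcont : Continuous fun x => ‖g x‖ ^ 2 * Real.log (Real.exp 1 + ‖g x‖ / s) :=
    (hg.norm.pow 2).mul ((continuous_const.add (hg.norm.div_const s)).log fun x => (hpos x).ne')
  have hc2 : HasCompactSupport fun x => ‖g x‖ ^ 2 := hc.norm.comp_left (zero_pow two_ne_zero)
  have hi2 : Integrable fun x => ‖g x‖ ^ 2 * Real.log (Real.exp 1 + ‖g x‖ / s) :=
    hcont.integrable_of_hasCompactSupport hc2.mul_right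
  refine integral_mono (integrable_sq hg hc) hi2 fun x => ?_
  have h1 := Literature.Barriers.NavierStokesRegularity.one_le_log_exp_one_add
    (div_nonneg (norm_nonneg (g x)) hs)
  have h0 : 0 ≤ ‖g x‖ ^ 2 := sq_nonneg _
  simpa using mul_le_mul_of_nonneg_left h1 h0

/-! ## The spread-out family `U_{a,b} = a • testDatum (b •)` of the Ramm test field -/

/-- The family: `U_{a,b}(x) = a U(b x)` (amplitude `a`, spatial rate `b`; `b → 0⁺` spreads the field
out; the quotient of (2.6) does not see `a`). [cite: Zeroual2026, Remark 2.5 (2.9) p.5 l.83–88] -/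
def fam (a b : ℝ) : E3 → E3 := scaleField a b testDatum

/-- `U_{a,b}` is smooth. [folklore] -/
theorem contDiff_fam (a b : ℝ) : ContDiff ℝ ∞ (fam a b) := contDiff_scaleField contDiff_testDatum a b

/-- `U_{a,b}` has compact support (`b ≠ 0`). [folklore] -/
theorem hasCompactSupport_fam (a : ℝ) {b : ℝ} (hb : b ≠ 0) : HasCompactSupport (fam a b) :=
  hasCompactSupport_scaleField hasCompactSupport_testDatum a hb

/-- `Δ U_{a,b}` is continuous. [folklore] -/
theorem continuous_laplacian_fam (a b : ℝ) : Continuous (Δ (fam a b)) :=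
  (contDiff_laplacian (n := 0) ((contDiff_fam a b).of_le (by norm_cast))).continuous

/-- `Δ U_{a,b}` has compact support (`b ≠ 0`). [folklore] -/
theorem hasCompactSupport_laplacian_fam (a : ℝ) {b : ℝ} (hb : b ≠ 0) :
    HasCompactSupport (Δ (fam a b)) :=
  hasCompactSupport_laplacian (hasCompactSupport_fam a hb)

/-- **The family lies in the typed class `D(A)`**: `C²`, divergence-free, `U_{a,b}, ΔU_{a,b} ∈ L²`
(`b ≠ 0`). [cite: Zeroual2026, Def 2.1 (2.3) p.5 l.19–26] -/
theorem inDA_fam (a : ℝ) {b : ℝ} (hb : b ≠ 0) : InDA (fam a b) :=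
  ⟨(contDiff_fam a b).of_le (by norm_cast),
    fun x => isDivFree_scaleField contDiff_testDatum isDivFree_testDatum a b x,
    lintegral_enorm_sq_lt_top (contDiff_fam a b).continuous (hasCompactSupport_fam a hb),
    lintegral_enorm_sq_lt_top (continuous_laplacian_fam a b) (hasCompactSupport_laplacian_fam a hb)⟩

/-- `‖U_{a,b}‖²_{L²} = a² b⁻³ ‖U‖²_{L²}` (`b > 0`; Mathlib `Measure.integral_comp_smul_of_nonneg`,
`dim = 3`). [cite: Zeroual2026, Remark 2.5 (2.8) p.5] -/
theorem l2Sq_fam (a : ℝ) {b : ℝ} (hb : 0 < b) :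
    l2Sq (fam a b) = a ^ 2 * (b ^ 3)⁻¹ * ∫ x, ‖testDatum x‖ ^ 2 := by
  rw [l2Sq_eq_integral (contDiff_fam a b).continuous]
  have h1 : (fun y => ‖fam a b y‖ ^ 2) = fun y => a ^ 2 * (fun x => ‖testDatum x‖ ^ 2) (b • y) := by
    funext y
    simp [fam, norm_smul, mul_pow]
  rw [h1, integral_const_mul, Measure.integral_comp_smul_of_nonneg volume (fun x => ‖testDatum x‖ ^ 2)
    b (hR := hb.le), finrank_euclideanSpace_fin, smul_eq_mul]
  ring

/-- `Δ U_{a,b} = (a b²) (ΔU)(b •)` pointwise (tree `laplacian_const_smul_comp_smul'`). [folklore] -/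
theorem laplacian_fam (a b : ℝ) (y : E3) : (Δ (fam a b)) y = (a * b ^ 2) • (Δ testDatum) (b • y) :=
  Literature.Analysis.PDE.LoewnerNirenberg.laplacian_const_smul_comp_smul' testDatum a b y

/-- `‖ΔU_{a,b}‖²_{L²} = a² b · ‖ΔU‖²_{L²}` (`b > 0`). [cite: Zeroual2026, Remark 2.5 (2.7) p.5] -/
theorem stokesSq_fam (a : ℝ) {b : ℝ} (hb : 0 < b) :
    stokesSq (fam a b) = a ^ 2 * b * ∫ x, ‖(Δ testDatum) x‖ ^ 2 := by
  unfold stokesSq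
  rw [l2Sq_eq_integral (continuous_laplacian_fam a b)]
  have h1 : (fun y => ‖(Δ (fam a b)) y‖ ^ 2) =
      fun y => (a * b ^ 2) ^ 2 * (fun x => ‖(Δ testDatum) x‖ ^ 2) (b • y) := by
    funext y
    rw [laplacian_fam, norm_smul, mul_pow, Real.norm_eq_abs, sq_abs]
  rw [h1, integral_const_mul]
  have h2 : ∀ w : E3 → E3, ∫ y : E3, (fun x => ‖w x‖ ^ 2) (b • y) = (b ^ 3)⁻¹ * ∫ x, ‖w x‖ ^ 2 := by
    intro w
    rw [Measure.integral_comp_smul_of_nonneg volume (fun x => ‖w x‖ ^ 2) b (hR := hb.le),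
      finrank_euclideanSpace_fin, smul_eq_mul]
  rw [h2 (Δ testDatum)]
  have hb3 : b ^ 3 ≠ 0 := pow_ne_zero 3 hb.ne'
  field_simp

/-- The base field has positive `L²` mass. [folklore] -/
theorem integral_sq_testDatum_pos : 0 < ∫ x, ‖testDatum x‖ ^ 2 := by
  obtain ⟨x₀, hx₀⟩ := Function.ne_iff.1 testDatum_ne_zero
  have hc : Continuous testDatum := contDiff_testDatum.continuous
  exact integral_pos_of_integrable_nonneg_nonzero (hc.norm.pow 2) (integrable_sq hc hasCompactSupport_testDatum)
    (fun x => sq_nonneg _) (pow_ne_zero 2 (norm_ne_zero_iff.2 hx₀))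

/-! ## The refutation -/

/-- **No positive lower bound, at any amplitude**: for every `c > 0` and every amplitude `a ≠ 0` some
`U_{a,b}` (`0 < b ≤ 1`) has `‖ΔU_{a,b}‖²_{L²} < c · ‖U_{a,b}‖²_{L² log L}` — the quotient of (2.6)/(4.1)
is `≤ b⁴ · ‖ΔU‖²/‖U‖² → 0` whatever `a` is (so the energy-ball variant of the constant — an infimum
over `0 < ‖u‖_{L²} ≤ E₀^{1/2}` — has no positive lower bound either: take `a` small).
[cite: Zeroual2026, Thm 4.1 (4.1) p.7 l.10–42; Remark 2.5 (2.9) p.5 l.83–88] -/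
theorem exists_violator {c : ℝ} (hc : 0 < c) {a : ℝ} (ha : a ≠ 0) :
    ∃ b : ℝ, 0 < b ∧ b ≤ 1 ∧ stokesSq (fam a b) < c * olSq (fam a b) := by
  set L : ℝ := ∫ x, ‖testDatum x‖ ^ 2 with hL
  set M : ℝ := ∫ x, ‖(Δ testDatum) x‖ ^ 2 with hM
  have hLpos : 0 < L := integral_sq_testDatum_pos
  have hM0 : 0 ≤ M := integral_nonneg fun _ => sq_nonneg _
  have ha2 : 0 < a ^ 2 := by positivity
  set b : ℝ := min 1 (c * L / (2 * (M + 1))) with hb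
  have hq : 0 < c * L / (2 * (M + 1)) := by positivity
  have hb0 : 0 < b := lt_min one_pos hq
  have hb1 : b ≤ 1 := min_le_left _ _
  refine ⟨b, hb0, hb1, ?_⟩
  have hol : l2Sq (fam a b) ≤ olSq (fam a b) :=
    l2Sq_le_olSq (contDiff_fam a b).continuous (hasCompactSupport_fam a hb0.ne')
  rw [l2Sq_fam a hb0] at hol
  rw [stokesSq_fam a hb0]
  have h1 : b ^ 4 ≤ b := by
    calc b ^ 4 ≤ b ^ 1 := pow_le_pow_of_le_one hb0.le hb1 (by norm_num)
      _ = b := pow_one b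
  have h2 : b * (M + 1) ≤ c * L / 2 := by
    have hmin : b ≤ c * L / (2 * (M + 1)) := min_le_right _ _
    have hM1 : 0 < M + 1 := by linarith
    calc b * (M + 1) ≤ c * L / (2 * (M + 1)) * (M + 1) := by gcongr
      _ = c * L / 2 := by field_simp
  have hkey : b * M < c * ((b ^ 3)⁻¹ * L) := by
    rw [show c * ((b ^ 3)⁻¹ * L) = (c * L) / b ^ 3 by field_simp]
    rw [lt_div_iff₀ (pow_pos hb0 3)]
    nlinarith
  have hkey' : a ^ 2 * b * M < c * (a ^ 2 * (b ^ 3)⁻¹ * L) := by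
    have := mul_lt_mul_of_pos_left hkey ha2
    calc a ^ 2 * b * M = a ^ 2 * (b * M) := by ring
      _ < a ^ 2 * (c * ((b ^ 3)⁻¹ * L)) := this
      _ = c * (a ^ 2 * (b ^ 3)⁻¹ * L) := by ring
  calc a ^ 2 * b * M < c * (a ^ 2 * (b ^ 3)⁻¹ * L) := hkey'
    _ ≤ c * olSq (fam a b) := by gcongr

/-- **Refutes `Step1_Thm41 K` for every constants package `K`** (Theorem 4.1 (4.1) p.7 l.10–42 with
Definition 2.4 (2.6) p.5 l.49–65: «C*_L = inf_{u ∈ D(A), u ≢ 0} ‖Au‖²_{L²}/‖u‖²_{L² log L} > 0 …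
independent of the solution u»): if `0 < K.Cstar` then the spread-out member `U_{1,b} ∈ D(A)` of
`exists_violator` breaks `K.Cstar · ‖U_{1,b}‖²_{L² log L} ≤ ‖ΔU_{1,b}‖²_{L²}`. [cite: Zeroual2026, Thm 4.1 (4.1) p.7 l.10–42; Def 2.4 (2.6) p.5 l.49–65] -/
theorem not_Step1_Thm41 (K : Constants) : ¬ Step1_Thm41 K := by
  rintro ⟨hle, hpos⟩
  obtain ⟨b, hb0, -, hlt⟩ := exists_violator hpos one_ne_zero
  exact absurd (hle (fam 1 b) (inDA_fam 1 hb0.ne')) (not_le.2 hlt)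

/-- info: 'Summit.NavierStokesRegularity.NavierStokesRegularity.Theorems.Zeroual2026.not_Step1_Thm41' depends on axioms: [propext, Classical.choice, Quot.sound] -/
#guard_msgs (whitespace := lax) in
#print axioms not_Step1_Thm41

end Summit.NavierStokesRegularity.NavierStokesRegularity.Theorems.Zeroual2026

end
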